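import Mathlib.LinearAlgebra.FiniteDimensional.Lemmas
import Mathlib.LinearAlgebra.Dimension.Constructions
import Mathlib.RingTheory.TensorProduct.Finite
import Mathlib.Order.CompactlyGenerated.Basic
import Mathlib.Algebra.Ring.Int.Parity
import Literature.AlgebraicGeometry.Motives.HodgeStructureProofs
import HarnessLib

/-!
# Weil's two-type Hodge structure attached to a Hodge structure of odd weight

For a pure `ℚ`-Hodge structure `H` of odd weight `n = 2m - 1` on `V`, the Weil operator `C`
(`C = i^{p-q}` on `V^{p,q}`) satisfies `C² = -1`, so `V_ℂ = V⁺ ⊕ V⁻` (the `±i`-eigenspaces),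
`conj V⁺ = V⁻`: "that is, `C` defines a weight-one Hodge structure `(H, C)`, and Weil's Jacobian
is its Jacobian" (Carlson–Müller-Stach–Peters, *Period Mappings and Period Domains*, 2nd ed.,
§3.5, eq. (3.5)); a polarization `Q` of `H` polarizes `(H, C)` ("the Weil Jacobian does get a
natural polarization and so it is an abelian variety", loc. cit.), because the Hodge
decomposition is orthogonal for `Q(x, conj y)` (Voisin, *Hodge Theory I*, §7.1.2, Def. 7.7 (i))
and the sign of `i^{p-q} Q(x, conj x)` on `V^{p,q} ⊆ V^±` only depends on the parity of `p`.

In the filtration language of `Literature.AlgebraicGeometry.Motives.HodgeStructure` the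
eigenspaces are `V⁺, V⁻ = ⊕_{p odd} V^{p,n-p}, ⊕_{p even} V^{p,n-p}` (which is which depends on
`n mod 4`). This file constructs, from `P := ⊕_{p odd} V^{p,n-p}` (`weilPiece`), the Hodge
structure `H.weil` of the SAME weight `n` with only two Hodge types, `V^{n,0} = P` and
`V^{0,n} = conj P` (filtration `F^j = V_ℂ` for `j ≤ 0`, `= P` for `0 < j ≤ n`, `= 0` for `j > n`;
`ofSplitting`): Weil's weight-one structure `(H, C)` with its two types relabelled
`(1,0) ↦ (n,0)`, `(0,1) ↦ (0,n)` (same underlying splitting `V_ℂ = P ⊕ conj P`; we keep the weight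
`n` so that `H ↦ H.weil` is an operation on `HodgeStructure V n`). We prove: morphisms of Hodge
structures stay morphisms (`Hom.weil`), a polarization of `H` is a polarization of `H.weil`
(`Polarization.weil`, hence `IsPolarizable.weil`), and `2 · h^{n,0}(H.weil) = dim_ℚ V`
(`two_mul_hodgeNumber_weil`), so `h^{n,0}(H.weil) ≠ 0` as soon as `V ≠ 0`. For weights that
are not odd and positive, `H.weil := H`.

Purpose: `H ↦ H.weil` is a functorial, polarization-preserving re-decoration of odd-degree
Hodge structures which does not touch even degrees (hence not Hodge classes); it is used in
`Literature/Barriers/HodgeConjecture/DecompositionOfTheDiagonalProofs.lean` to show that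
statements about the Hodge numbers `h^{l,0}` of an ABSTRACT Betti–Hodge realization datum
(`BettiHodgeData`) in odd degree `l` are not consequences of its axioms.

## Main statements

* `HodgeStructure.ofSplitting P hP hn`: the two-type Hodge structure of weight `n > 0` defined by
  a splitting `V_ℂ = P ⊕ conj P`; `piece_ofSplitting_self_zero`, `piece_ofSplitting_zero_self`,
  `piece_ofSplitting_eq_bot`, `hodgeNumber_ofSplitting`.
* `HodgeStructure.weilPiece`, `isCompl_weilPiece` (odd weight), `HodgeStructure.weil`,
  `Hom.weil`, `Polarization.weil`, `two_mul_hodgeNumber_weil`, `hodgeNumber_weil_ne_zero`.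
* On the way: `form_baseChange_conj` (`Q_ℂ(conj x, conj y) = conj Q_ℂ(x, y)`),
  `Polarization.form_piece_piece` (`Q_ℂ(V^{p,·}, V^{p',·}) = 0` for `p + p' ≠ n`),
  `Polarization.form_piece_conj_piece` (orthogonality of the Hodge decomposition for
  `Q(x, conj y)`), `Hom.map_piece_le`.

## References

* J. Carlson, S. Müller-Stach, C. Peters, *Period Mappings and Period Domains*, 2nd ed.,
  CUP 2017, §3.5, eq. (3.5) (Weil's Jacobian, its polarization).
* C. Voisin, *Hodge Theory and Complex Algebraic Geometry I*, CUP 2002, §7.1.2, Def. 7.7.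
* P. Deligne, *Théorie de Hodge II*, Publ. Math. IHÉS 40 (1971), 1.2.5, 2.1.15.
-/

open scoped TensorProduct

noncomputable section

namespace Literature.AlgebraicGeometry.Motives

namespace HodgeStructure

universe u v

variable {V : Type u} [AddCommGroup V] [Module ℚ V]
variable {W : Type v} [AddCommGroup W] [Module ℚ W]
variable {n : ℤ}

/-! ### Complex conjugation and rational bilinear forms -/

/-- The complexification of a rational bilinear form commutes with complex conjugation:
`Q_ℂ(conj x, conj y) = conj (Q_ℂ(x, y))` (`Q_ℂ` is defined over `ℚ ⊆ ℝ`; Deligne, Hodge II,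
2.1.15, where `Q` is real on the real structure). [folklore] -/
theorem form_baseChange_conj (Q : LinearMap.BilinForm ℚ V) (x y : ℂ ⊗[ℚ] V) :
    Q.baseChange ℂ (conj x) (conj y) = starRingEnd ℂ (Q.baseChange ℂ x y) := by
  induction x using TensorProduct.induction_on with
  | zero => simp
  | tmul a v =>
    induction y using TensorProduct.induction_on with
    | zero => simp
    | tmul b w =>
      simp only [conj_tmul, LinearMap.BilinForm.baseChange_tmul, Rat.smul_def, map_mul,
        map_ratCast]
    | add y₁ y₂ h₁ h₂ => simp only [map_add, h₁, h₂]
  | add x₁ x₂ h₁ h₂ => simp only [map_add, LinearMap.add_apply, h₁, h₂]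

/-! ### Two-type Hodge structures defined by a splitting `V_ℂ = P ⊕ conj P` -/

/-- The two-step filtration `F^j = V_ℂ` (`j ≤ 0`), `F^j = P` (`0 < j ≤ n`), `F^j = 0` (`j > n`)
attached to a subspace `P ⊆ V_ℂ` and an integer `n`. [folklore] -/
def twoStepFiltration (P : Submodule ℂ (ℂ ⊗[ℚ] V)) (n j : ℤ) : Submodule ℂ (ℂ ⊗[ℚ] V) :=
  if j ≤ 0 then ⊤ else if j ≤ n then P else ⊥

/-- Below `0` the two-step filtration is everything. [folklore] -/
theorem twoStepFiltration_of_le_zero (P : Submodule ℂ (ℂ ⊗[ℚ] V)) {n j : ℤ} (h : j ≤ 0) :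
    twoStepFiltration P n j = ⊤ := if_pos h

/-- Strictly between `0` and `n` (inclusive) the two-step filtration is `P`. [folklore] -/
theorem twoStepFiltration_of_pos_of_le (P : Submodule ℂ (ℂ ⊗[ℚ] V)) {n j : ℤ} (h0 : 0 < j)
    (h : j ≤ n) : twoStepFiltration P n j = P := by
  rw [twoStepFiltration, if_neg (not_le.2 h0), if_pos h]

/-- Above `n` (and `0`) the two-step filtration is zero. [folklore] -/
theorem twoStepFiltration_of_lt (P : Submodule ℂ (ℂ ⊗[ℚ] V)) {n j : ℤ} (h0 : 0 < j) (h : n < j) :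
    twoStepFiltration P n j = ⊥ := by
  rw [twoStepFiltration, if_neg (not_le.2 h0), if_neg (not_le.2 h)]

/-- The two-step filtration is decreasing. [folklore] -/
theorem antitone_twoStepFiltration (P : Submodule ℂ (ℂ ⊗[ℚ] V)) (n : ℤ) :
    Antitone (twoStepFiltration P n) := by
  intro i j hij
  by_cases hi : i ≤ 0
  · rw [twoStepFiltration_of_le_zero P hi]
    exact le_top
  by_cases hjn : n < j
  · rw [twoStepFiltration_of_lt P (lt_of_lt_of_le (not_le.1 hi) hij) hjn]
    exact bot_le
  have hin : i ≤ n := hij.trans (not_lt.1 hjn)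
  rw [twoStepFiltration_of_pos_of_le P (not_le.1 hi) hin,
    twoStepFiltration_of_pos_of_le P (lt_of_lt_of_le (not_le.1 hi) hij) (not_lt.1 hjn)]

/-- **The two-type Hodge structure of a splitting.** A `ℂ`-subspace `P ⊆ V_ℂ` with
`V_ℂ = P ⊕ conj P` defines, for every weight `n > 0`, the pure Hodge structure on `V` with
`V^{n,0} = P`, `V^{0,n} = conj P` and no other types: `F^j = V_ℂ` for `j ≤ 0`, `P` for
`0 < j ≤ n`, `0` for `j > n`. For `n = 1` this is the Hodge structure of weight one defined by a
complex structure / a complex torus (Carlson–Müller-Stach–Peters §3.5: `H_ℂ = H⁺ ⊕ H⁻`,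
`conj H⁺ = H⁻` "defines a weight-one Hodge structure"); for general `n` it is the same splitting
with the two types labelled `(n, 0)`, `(0, n)`. [cite: CarlsonMullerStachPeters2017, §3.5 eq. (3.5)] -/
def ofSplitting (P : Submodule ℂ (ℂ ⊗[ℚ] V)) (hP : IsCompl P (complexConj P)) (hn : 0 < n) :
    HodgeStructure V n where
  F := twoStepFiltration P n
  antitone_F := antitone_twoStepFiltration P n
  exists_F_eq_top := ⟨0, twoStepFiltration_of_le_zero P le_rfl⟩
  exists_F_eq_bot := ⟨n + 1, twoStepFiltration_of_lt P (by omega) (by omega)⟩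
  isCompl_F_complexConj p q h := by
    by_cases hp : p ≤ 0
    · rw [twoStepFiltration_of_le_zero P hp, twoStepFiltration_of_lt P (by omega) (by omega),
        complexConj_bot]
      exact isCompl_top_bot
    by_cases hpn : n < p
    · rw [twoStepFiltration_of_lt P (not_le.1 hp) hpn, twoStepFiltration_of_le_zero P (by omega),
        complexConj_top]
      exact isCompl_bot_top
    rw [twoStepFiltration_of_pos_of_le P (not_le.1 hp) (not_lt.1 hpn),
      twoStepFiltration_of_pos_of_le P (by omega) (by omega)]
    exact hP

/-- The Hodge filtration of `ofSplitting`. [folklore] -/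
@[simp]
theorem ofSplitting_F (P : Submodule ℂ (ℂ ⊗[ℚ] V)) (hP : IsCompl P (complexConj P)) (hn : 0 < n)
    (j : ℤ) : (ofSplitting P hP hn).F j = twoStepFiltration P n j := rfl

/-- `V^{n,0} = P` for the two-type structure of the splitting `V_ℂ = P ⊕ conj P`. [folklore] -/
theorem piece_ofSplitting_self_zero (P : Submodule ℂ (ℂ ⊗[ℚ] V)) (hP : IsCompl P (complexConj P))
    (hn : 0 < n) : (ofSplitting P hP hn).piece n 0 = P := by
  rw [piece_of_add_eq _ (add_zero n), ofSplitting_F, ofSplitting_F,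
    twoStepFiltration_of_pos_of_le P hn le_rfl, twoStepFiltration_of_le_zero P le_rfl,
    complexConj_top, inf_top_eq]

/-- `V^{0,n} = conj P` for the two-type structure of the splitting `V_ℂ = P ⊕ conj P`. [folklore] -/
theorem piece_ofSplitting_zero_self (P : Submodule ℂ (ℂ ⊗[ℚ] V)) (hP : IsCompl P (complexConj P))
    (hn : 0 < n) : (ofSplitting P hP hn).piece 0 n = complexConj P := by
  rw [piece_of_add_eq _ (zero_add n), ofSplitting_F, ofSplitting_F,
    twoStepFiltration_of_pos_of_le P hn le_rfl, twoStepFiltration_of_le_zero P le_rfl, top_inf_eq]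

/-- All Hodge pieces of the two-type structure other than `V^{n,0}`, `V^{0,n}` vanish. [folklore] -/
theorem piece_ofSplitting_eq_bot (P : Submodule ℂ (ℂ ⊗[ℚ] V)) (hP : IsCompl P (complexConj P))
    (hn : 0 < n) {p q : ℤ} (h₁ : ¬(p = n ∧ q = 0)) (h₂ : ¬(p = 0 ∧ q = n)) :
    (ofSplitting P hP hn).piece p q = ⊥ := by
  by_cases hpq : p + q = n
  · rw [piece_of_add_eq _ hpq, ofSplitting_F, ofSplitting_F]
    by_cases hp : p ≤ 0
    · have hq : n < q := by omega
      rw [twoStepFiltration_of_lt P (by omega) hq, complexConj_bot, inf_bot_eq]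
    by_cases hpn : n < p
    · rw [twoStepFiltration_of_lt P (not_le.1 hp) hpn, bot_inf_eq]
    have hq0 : 0 < q := by omega
    have hqn : q ≤ n := by omega
    rw [twoStepFiltration_of_pos_of_le P (not_le.1 hp) (not_lt.1 hpn),
      twoStepFiltration_of_pos_of_le P hq0 hqn]
    exact hP.inf_eq_bot
  · exact piece_eq_bot_of_add_ne _ hpq

/-- `h^{n,0} = dim_ℂ P` for the two-type structure of the splitting `V_ℂ = P ⊕ conj P`. [folklore] -/
theorem hodgeNumber_ofSplitting (P : Submodule ℂ (ℂ ⊗[ℚ] V)) (hP : IsCompl P (complexConj P))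
    (hn : 0 < n) : (ofSplitting P hP hn).hodgeNumber n 0 = Module.finrank ℂ P := by
  rw [hodgeNumber, piece_ofSplitting_self_zero]

/-- For a splitting `V_ℂ = P ⊕ conj P` of a finite-dimensional `V`, `dim P + dim conj P = dim_ℚ V`.
[folklore] -/
theorem finrank_add_finrank_complexConj [Module.Finite ℚ V] (P : Submodule ℂ (ℂ ⊗[ℚ] V))
    (hP : IsCompl P (complexConj P)) :
    Module.finrank ℂ P + Module.finrank ℂ (complexConj P) = Module.finrank ℚ V := by
  have h := Submodule.finrank_sup_add_finrank_inf_eq P (complexConj P)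
  rw [hP.sup_eq_top, hP.inf_eq_bot, finrank_bot, finrank_top, add_zero,
    Module.finrank_baseChange] at h
  exact h.symm

/-- `2 · h^{n,0} = dim_ℚ V` for the two-type structure of a splitting of a finite-dimensional `V`
(`h^{n,0} = h^{0,n}` by Hodge symmetry and `V_ℂ = V^{n,0} ⊕ V^{0,n}`). [folklore] -/
theorem two_mul_hodgeNumber_ofSplitting [Module.Finite ℚ V] (P : Submodule ℂ (ℂ ⊗[ℚ] V))
    (hP : IsCompl P (complexConj P)) (hn : 0 < n) :
    2 * (ofSplitting P hP hn).hodgeNumber n 0 = Module.finrank ℚ V := by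
  have h₁ := hodgeNumber_ofSplitting P hP hn
  have h₂ : (ofSplitting P hP hn).hodgeNumber n 0 = Module.finrank ℂ (complexConj P) := by
    rw [hodgeNumber_symm_holds, hodgeNumber, piece_ofSplitting_zero_self]
  rw [two_mul]
  nth_rewrite 1 [h₁]
  rw [h₂]
  exact finrank_add_finrank_complexConj P hP

/-! ### Morphisms and Hodge pieces -/

/-- A morphism of Hodge structures maps `V^{p,q}` into `W^{p,q}`: it respects `F^p`, and, being
defined over `ℚ`, commutes with `conj`, hence respects `conj F^q` (Voisin I, §7.3.1; Deligne,
Hodge II, 2.1.6). [folklore] -/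
theorem Hom.map_piece_le {H₁ : HodgeStructure V n} {H₂ : HodgeStructure W n} (f : Hom H₁ H₂)
    (p q : ℤ) : (H₁.piece p q).map (f.toLinearMap.baseChange ℂ) ≤ H₂.piece p q := by
  by_cases hpq : p + q = n
  · rintro _ ⟨x, hx, rfl⟩
    rw [SetLike.mem_coe, mem_piece_iff _ hpq] at hx
    rw [mem_piece_iff _ hpq, conj_baseChange]
    exact ⟨f.map_F_le p ⟨x, hx.1, rfl⟩, f.map_F_le q ⟨conj x, hx.2, rfl⟩⟩
  · rw [piece_eq_bot_of_add_ne _ hpq, piece_eq_bot_of_add_ne _ hpq, Submodule.map_bot]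

/-! ### Polarizations and the Hodge decomposition -/

/-- First Hodge–Riemann relation on Hodge pieces: `Q_ℂ(V^{p,n-p}, V^{p',n-p'}) = 0` unless
`p + p' = n`. For `p + p' > n` this is `Q_ℂ(F^p, F^{n+1-p}) = 0`; for `p + p' < n` apply the same
to `conj x ∈ F^{n-p}`, `conj y ∈ F^{n-p'}` and use `Q_ℂ(conj x, conj y) = conj Q_ℂ(x, y)`
(Voisin I, §7.1.2, Def. 7.7 (i)). [cite: VoisinHodgeI2002, §7.1.2 Def. 7.7] -/
theorem Polarization.form_piece_piece {H : HodgeStructure V n} (Q : Polarization H) {p p' : ℤ}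
    (h : p + p' ≠ n) {x y : ℂ ⊗[ℚ] V} (hx : x ∈ H.piece p (n - p))
    (hy : y ∈ H.piece p' (n - p')) : Q.form.baseChange ℂ x y = 0 := by
  rw [mem_piece_iff _ (by ring)] at hx hy
  rcases lt_or_gt_of_ne h with hlt | hgt
  · have hy' : conj y ∈ H.F (n + 1 - (n - p)) := H.antitone_F (by omega) hy.2
    have h0 := Q.form_apply_eq_zero (n - p) (conj x) hx.2 (conj y) hy'
    rw [form_baseChange_conj] at h0
    simpa using h0
  · exact Q.form_apply_eq_zero p x hx.1 y (H.antitone_F (by omega) hy.1)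

/-- **The Hodge decomposition is orthogonal for `Q(x, conj y)`:** `Q_ℂ(x, conj y) = 0` for
`x ∈ V^{p,n-p}`, `y ∈ V^{p',n-p'}`, `p ≠ p'` (Voisin I, §7.1.2, Def. 7.7 (i): "the Hodge
decomposition is orthogonal for `H(α, β) = i^k Q(α, conj β)`"). [cite: VoisinHodgeI2002, §7.1.2 Def. 7.7] -/
theorem Polarization.form_piece_conj_piece {H : HodgeStructure V n} (Q : Polarization H)
    {p p' : ℤ} (h : p ≠ p') {x y : ℂ ⊗[ℚ] V} (hx : x ∈ H.piece p (n - p))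
    (hy : y ∈ H.piece p' (n - p')) : Q.form.baseChange ℂ x (conj y) = 0 := by
  have hy' : conj y ∈ H.piece (n - p') (n - (n - p')) := by
    rw [sub_sub_cancel]
    exact conj_mem_piece H hy
  exact Q.form_piece_piece (p' := n - p') (by omega) hx hy'

/-- Membership in a guarded piece `⨆ (_ : S p), V^{p,n-p}`: either `S p` and `x ∈ V^{p,n-p}`, or
`x = 0`. [folklore] -/
theorem mem_piece_or_eq_zero_of_mem_iSup_prop (H : HodgeStructure V n) {S : ℤ → Prop} {p : ℤ}
    {x : ℂ ⊗[ℚ] V} (hx : x ∈ ⨆ (_ : S p), H.piece p (n - p)) :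
    (S p ∧ x ∈ H.piece p (n - p)) ∨ x = 0 := by
  by_cases hp : S p
  · rw [iSup_pos hp] at hx
    exact Or.inl ⟨hp, hx⟩
  · rw [iSup_neg hp, Submodule.mem_bot] at hx
    exact Or.inr hx

/-- `Q_ℂ` vanishes identically on `⊕_{S p} V^{p,n-p}` as soon as `p + p' ≠ n` for all `p, p'` in
`S` (e.g. `S` = odd integers, `n` odd): the first Hodge–Riemann relation for the sum.
[cite: VoisinHodgeI2002, §7.1.2 Def. 7.7] -/
theorem Polarization.form_eq_zero_of_mem_biSup {H : HodgeStructure V n} (Q : Polarization H)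
    {S : ℤ → Prop} (hS : ∀ p p', S p → S p' → p + p' ≠ n) {x y : ℂ ⊗[ℚ] V}
    (hx : x ∈ ⨆ (p : ℤ) (_ : S p), H.piece p (n - p))
    (hy : y ∈ ⨆ (p : ℤ) (_ : S p), H.piece p (n - p)) : Q.form.baseChange ℂ x y = 0 := by
  induction hx using Submodule.iSup_induction' with
  | mem p x hx =>
    rcases H.mem_piece_or_eq_zero_of_mem_iSup_prop hx with ⟨hp, hx⟩ | rfl
    · induction hy using Submodule.iSup_induction' with
      | mem p' y hy =>
        rcases H.mem_piece_or_eq_zero_of_mem_iSup_prop hy with ⟨hp', hy⟩ | rfl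
        · exact Q.form_piece_piece (hS p p' hp hp') hx hy
        · simp
      | zero => simp
      | add y₁ y₂ _ _ h₁ h₂ => rw [map_add, h₁, h₂, add_zero]
    · simp
  | zero => simp
  | add x₁ x₂ _ _ h₁ h₂ => rw [map_add, LinearMap.add_apply, h₁, h₂, add_zero]

/-- Orthogonality of one guarded piece `⨆ (_ : S a), V^{a,n-a}` to a finite sum of other guarded
pieces, for `Q(x, conj y)` in both orders (from `form_piece_conj_piece`).
[cite: VoisinHodgeI2002, §7.1.2 Def. 7.7] -/
theorem Polarization.form_conj_eq_zero_of_mem_biSup_finset {H : HodgeStructure V n}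
    (Q : Polarization H) {S : ℤ → Prop} {s : Finset ℤ} {a : ℤ} (ha : a ∉ s) {z y : ℂ ⊗[ℚ] V}
    (hz : z ∈ ⨆ (_ : S a), H.piece a (n - a))
    (hy : y ∈ ⨆ p ∈ s, ⨆ (_ : S p), H.piece p (n - p)) :
    Q.form.baseChange ℂ z (conj y) = 0 ∧ Q.form.baseChange ℂ y (conj z) = 0 := by
  rcases H.mem_piece_or_eq_zero_of_mem_iSup_prop hz with ⟨-, hz⟩ | rfl
  · induction hy using Submodule.iSup_induction' with
    | mem p y hy =>
      by_cases hps : p ∈ s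
      · rw [iSup_pos hps] at hy
        rcases H.mem_piece_or_eq_zero_of_mem_iSup_prop hy with ⟨-, hy⟩ | rfl
        · have hne : a ≠ p := fun h => ha (h ▸ hps)
          exact ⟨Q.form_piece_conj_piece hne hz hy, Q.form_piece_conj_piece hne.symm hy hz⟩
        · simp
      · rw [iSup_neg hps, Submodule.mem_bot] at hy
        simp [hy]
    | zero => simp
    | add y₁ y₂ _ _ h₁ h₂ =>
      rw [map_add, map_add, map_add, LinearMap.add_apply, h₁.1, h₂.1, h₁.2, h₂.2, add_zero]
      exact ⟨rfl, rfl⟩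
  · simp

/-- Second Hodge–Riemann relation on one guarded piece, with a uniform phase: if
`i^a (i^{n-a})⁻¹ = c` on `S`, then for `z ∈ ⨆ (_ : S a), V^{a,n-a}` the number `c · Q_ℂ(z, conj z)`
is a real `r ≥ 0`, positive if `z ≠ 0`. [cite: VoisinHodgeI2002, §7.1.2 Def. 7.7] -/
theorem Polarization.exists_nonneg_of_mem_iSup_prop {H : HodgeStructure V n} (Q : Polarization H)
    {S : ℤ → Prop} {c : ℂ} (hc : ∀ p, S p → Complex.I ^ p * (Complex.I ^ (n - p))⁻¹ = c) {a : ℤ}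
    {z : ℂ ⊗[ℚ] V} (hz : z ∈ ⨆ (_ : S a), H.piece a (n - a)) :
    ∃ r : ℝ, 0 ≤ r ∧ c * Q.form.baseChange ℂ z (conj z) = r ∧ (z ≠ 0 → 0 < r) := by
  rcases H.mem_piece_or_eq_zero_of_mem_iSup_prop hz with ⟨ha, hz⟩ | rfl
  · by_cases hz0 : z = 0
    · exact ⟨0, le_rfl, by simp [hz0], fun h => (h hz0).elim⟩
    · obtain ⟨r, hr, hQ⟩ := Q.pos a (n - a) (by ring) z hz hz0
      refine ⟨r, hr.le, ?_, fun _ => hr⟩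
      rw [← hc a ha, hQ]
  · exact ⟨0, le_rfl, by simp, fun h => (h rfl).elim⟩

/-- **Positivity of a polarization on a half of the Hodge decomposition with uniform phase.**
If `i^p (i^{n-p})⁻¹ = c` for all `p` in `S`, then for every non-zero `x ∈ ⊕_{S p} V^{p,n-p}` the
number `c · Q_ℂ(x, conj x)` is real and positive: writing `x = Σ x_p`, the cross terms vanish
(`form_piece_conj_piece`) and each `c · Q_ℂ(x_p, conj x_p) = i^p (i^{n-p})⁻¹ Q_ℂ(x_p, conj x_p)`
is `≥ 0`, `> 0` for `x_p ≠ 0` (Voisin I, §7.1.2, Def. 7.7 (i)–(ii); this is the computation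
behind the polarization of Weil's Jacobian, Carlson–Müller-Stach–Peters §3.5).
[cite: VoisinHodgeI2002, §7.1.2 Def. 7.7] -/
theorem Polarization.exists_pos_of_mem_biSup {H : HodgeStructure V n} (Q : Polarization H)
    {S : ℤ → Prop} {c : ℂ} (hc : ∀ p, S p → Complex.I ^ p * (Complex.I ^ (n - p))⁻¹ = c)
    {x : ℂ ⊗[ℚ] V} (hx : x ∈ ⨆ (p : ℤ) (_ : S p), H.piece p (n - p)) (hx0 : x ≠ 0) :
    ∃ r : ℝ, 0 < r ∧ c * Q.form.baseChange ℂ x (conj x) = r := by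
  obtain ⟨s, hs⟩ := Submodule.mem_iSup_iff_exists_finset.1 hx
  suffices key : ∀ (t : Finset ℤ) (y : ℂ ⊗[ℚ] V), (y ∈ ⨆ p ∈ t, ⨆ (_ : S p), H.piece p (n - p)) →
      ∃ r : ℝ, 0 ≤ r ∧ c * Q.form.baseChange ℂ y (conj y) = r ∧ (y ≠ 0 → 0 < r) by
    obtain ⟨r, -, hr, hpos⟩ := key s x hs
    exact ⟨r, hpos hx0, hr⟩
  intro t
  induction t using Finset.induction_on with
  | empty =>
    intro y hy
    have hy0 : y = 0 := by simpa using hy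
    exact ⟨0, le_rfl, by simp [hy0], fun h => (h hy0).elim⟩
  | insert a s ha ih =>
    intro y hy
    rw [Finset.iSup_insert, Submodule.mem_sup] at hy
    obtain ⟨z, hz, w, hw, rfl⟩ := hy
    obtain ⟨r₁, hr₁, hQ₁, hpos₁⟩ := Q.exists_nonneg_of_mem_iSup_prop hc hz
    obtain ⟨r₂, hr₂, hQ₂, hpos₂⟩ := ih w hw
    obtain ⟨hzw, hwz⟩ := Q.form_conj_eq_zero_of_mem_biSup_finset ha hz hw
    refine ⟨r₁ + r₂, add_nonneg hr₁ hr₂, ?_, fun hne => ?_⟩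
    · simp only [map_add, LinearMap.add_apply]
      rw [hzw, hwz, add_zero, zero_add, mul_add, hQ₁, hQ₂, Complex.ofReal_add]
    · by_cases hz0 : z = 0
      · have hw0 : w ≠ 0 := fun hw0 => hne (by rw [hz0, hw0, add_zero])
        exact add_pos_of_nonneg_of_pos hr₁ (hpos₂ hw0)
      · exact add_pos_of_pos_of_nonneg (hpos₁ hz0) hr₂

/-! ### Weil's half `⊕_{p odd} V^{p,n-p}` and the two-type structure `H.weil` -/

/-- **Weil's half of the Hodge decomposition:** `P = ⊕_{p odd} V^{p,n-p}`. For odd weight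
`n = 2m - 1` this is one of the two eigenspaces `V^±` of the Weil operator `C = i^{p-q}` on
`V^{p,q}` (`C² = -1`; which one depends on `n mod 4`), and `conj P = ⊕_{p even} V^{p,n-p}` is the
other (Carlson–Müller-Stach–Peters, §3.5, eq. (3.5)). [cite: CarlsonMullerStachPeters2017, §3.5 eq. (3.5)] -/
def weilPiece (H : HodgeStructure V n) : Submodule ℂ (ℂ ⊗[ℚ] V) :=
  ⨆ (p : ℤ) (_ : Odd p), H.piece p (n - p)

/-- `V^{p,n-p} ⊆ conj (⊕_{S q} V^{q,n-q})` whenever `S (n - p)`, since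
`V^{p,n-p} = conj V^{n-p,p}` (Hodge symmetry). [folklore] -/
theorem piece_le_complexConj_biSup (H : HodgeStructure V n) {S : ℤ → Prop} {p : ℤ}
    (h : S (n - p)) : H.piece p (n - p) ≤ complexConj (⨆ (q : ℤ) (_ : S q), H.piece q (n - q)) := by
  have hpq : H.piece p (n - p) = complexConj (H.piece (n - p) (n - (n - p))) := by
    rw [sub_sub_cancel, complexConj_piece]
  rw [hpq]
  exact complexConj_mono (le_iSup₂_of_le (n - p) h le_rfl)

/-- For odd weight, Weil's half and its conjugate span `V_ℂ`: every `V^{p,n-p}` lies in `P`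
(`p` odd) or in `conj P` (`p` even, so `n - p` odd), and `V_ℂ = ⊕_p V^{p,n-p}`
(`iSup_piece_eq_top_holds`). [cite: CarlsonMullerStachPeters2017, §3.5 eq. (3.5)] -/
theorem weilPiece_sup_complexConj (H : HodgeStructure V n) (hn : Odd n) :
    H.weilPiece ⊔ complexConj H.weilPiece = ⊤ := by
  refine eq_top_iff.2 ?_
  rw [← iSup_piece_eq_top_holds H]
  refine iSup_le fun p => ?_
  rcases Int.even_or_odd p with hp | hp
  · exact le_sup_of_le_right (H.piece_le_complexConj_biSup (S := Odd) (hn.sub_even hp))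
  · exact le_sup_of_le_left (le_iSup₂_of_le (f := fun (q : ℤ) (_ : Odd q) => H.piece q (n - q))
      p hp le_rfl)

/-- For odd weight, `conj P ⊆ ⊕_{p even} V^{p,n-p}` for Weil's half `P`. [folklore] -/
theorem complexConj_weilPiece_le (H : HodgeStructure V n) (hn : Odd n) :
    complexConj H.weilPiece ≤ ⨆ (p : ℤ) (_ : Even p), H.piece p (n - p) := by
  suffices h : H.weilPiece ≤ complexConj (⨆ (p : ℤ) (_ : Even p), H.piece p (n - p)) by
    simpa using complexConj_mono h
  exact iSup₂_le fun p hp => H.piece_le_complexConj_biSup (S := Even) (hn.sub_odd hp)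

/-- For odd weight, Weil's half meets its conjugate in `0`: the pieces `V^{p,n-p}` are
independent (`iSupIndep_piece_holds`) and the odd and even indices are disjoint.
[cite: CarlsonMullerStachPeters2017, §3.5 eq. (3.5)] -/
theorem disjoint_weilPiece_complexConj (H : HodgeStructure V n) (hn : Odd n) :
    Disjoint H.weilPiece (complexConj H.weilPiece) := by
  refine Disjoint.mono_right (H.complexConj_weilPiece_le hn) ?_
  have hst : Disjoint {p : ℤ | Odd p} {p : ℤ | Even p} :=
    Set.disjoint_left.2 fun p hp he => (Int.not_even_iff_odd.2 hp) he
  exact (iSupIndep_piece_holds H).disjoint_biSup_biSup hst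

/-- **Weil's splitting** `V_ℂ = P ⊕ conj P`, `P = ⊕_{p odd} V^{p,n-p}`, of a Hodge structure of
odd weight (Carlson–Müller-Stach–Peters, §3.5, eq. (3.5): `H_ℂ = H⁺ ⊕ H⁻`, `conj H⁺ = H⁻`).
[cite: CarlsonMullerStachPeters2017, §3.5 eq. (3.5)] -/
theorem isCompl_weilPiece (H : HodgeStructure V n) (hn : Odd n) :
    IsCompl H.weilPiece (complexConj H.weilPiece) :=
  ⟨H.disjoint_weilPiece_complexConj hn, codisjoint_iff.2 (H.weilPiece_sup_complexConj hn)⟩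

/-- **Weil's two-type Hodge structure `H.weil`.** For `H` of odd weight `n > 0`: the Hodge
structure of weight `n` on `V` with `V^{n,0} = ⊕_{p odd} V^{p,n-p}`, `V^{0,n}` its conjugate, and
no other types — Weil's weight-one Hodge structure `(H, C)` of Carlson–Müller-Stach–Peters §3.5,
eq. (3.5) (whose Jacobian is Weil's intermediate Jacobian) with its types `(1,0)`, `(0,1)`
relabelled `(n,0)`, `(0,n)`. For any other weight, `H.weil := H`. [cite: CarlsonMullerStachPeters2017, §3.5 eq. (3.5)] -/
def weil (H : HodgeStructure V n) : HodgeStructure V n :=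
  if h : Odd n ∧ 0 < n then ofSplitting H.weilPiece (H.isCompl_weilPiece h.1) h.2 else H

/-- Off the odd positive weights, `H.weil = H`. [folklore] -/
theorem weil_of_not (H : HodgeStructure V n) (h : ¬(Odd n ∧ 0 < n)) : H.weil = H := dif_neg h

/-- For odd positive weight, `H.weil` is the two-type structure of Weil's splitting. [folklore] -/
theorem weil_of (H : HodgeStructure V n) (h : Odd n ∧ 0 < n) :
    H.weil = ofSplitting H.weilPiece (H.isCompl_weilPiece h.1) h.2 := dif_pos h

/-- The Hodge filtration of `H.weil` in odd positive weight is the two-step filtration of Weil's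
half. [folklore] -/
theorem weil_F (H : HodgeStructure V n) (h : Odd n ∧ 0 < n) (j : ℤ) :
    H.weil.F j = twoStepFiltration H.weilPiece n j := by
  rw [weil_of H h, ofSplitting_F]

/-- `h^{n,0}(H.weil) = dim_ℂ ⊕_{p odd} V^{p,n-p}` in odd positive weight. [folklore] -/
theorem hodgeNumber_weil (H : HodgeStructure V n) (h : Odd n ∧ 0 < n) :
    H.weil.hodgeNumber n 0 = Module.finrank ℂ H.weilPiece := by
  rw [weil_of H h, hodgeNumber_ofSplitting]

/-- **`2 · h^{n,0}(H.weil) = dim_ℚ V`** in odd positive weight (finite-dimensional `V`): the two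
types `(n,0)`, `(0,n)` are conjugate and exhaust `V_ℂ` (Carlson–Müller-Stach–Peters §3.5:
Weil's Jacobian is a complex torus of dimension `½ b`). [cite: CarlsonMullerStachPeters2017, §3.5 eq. (3.5)] -/
theorem two_mul_hodgeNumber_weil [Module.Finite ℚ V] (H : HodgeStructure V n) (h : Odd n ∧ 0 < n) :
    2 * H.weil.hodgeNumber n 0 = Module.finrank ℚ V := by
  rw [weil_of H h]
  exact two_mul_hodgeNumber_ofSplitting _ _ _

/-- In odd positive weight on a non-zero finite-dimensional `V`, `h^{n,0}(H.weil) ≠ 0`. [folklore] -/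
theorem hodgeNumber_weil_ne_zero [Module.Finite ℚ V] [Nontrivial V] (H : HodgeStructure V n)
    (h : Odd n ∧ 0 < n) : H.weil.hodgeNumber n 0 ≠ 0 := by
  intro h0
  have h2 := H.two_mul_hodgeNumber_weil h
  rw [h0, mul_zero] at h2
  exact Module.finrank_pos.ne' h2.symm

/-! ### Functoriality -/

/-- A morphism of Hodge structures maps Weil's half into Weil's half (it maps each `V^{p,q}` into
`W^{p,q}`). [folklore] -/
theorem Hom.map_weilPiece_le {H₁ : HodgeStructure V n} {H₂ : HodgeStructure W n} (f : Hom H₁ H₂) :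
    H₁.weilPiece.map (f.toLinearMap.baseChange ℂ) ≤ H₂.weilPiece := by
  rw [weilPiece, Submodule.map_iSup]
  refine iSup_le fun p => ?_
  rw [Submodule.map_iSup]
  exact iSup_le fun hp => (f.map_piece_le p (n - p)).trans
    (le_iSup₂_of_le (f := fun (q : ℤ) (_ : Odd q) => H₂.piece q (n - q)) p hp le_rfl)

/-- **Functoriality of `H ↦ H.weil`:** a morphism of Hodge structures `H₁ → H₂` is, with the same
underlying `ℚ`-linear map, a morphism `H₁.weil → H₂.weil` (Weil's splitting is by eigenspaces of
the Weil operator, which morphisms commute with; Carlson–Müller-Stach–Peters §3.5). [folklore] -/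
def Hom.weil {H₁ : HodgeStructure V n} {H₂ : HodgeStructure W n} (f : Hom H₁ H₂) :
    Hom H₁.weil H₂.weil where
  toLinearMap := f.toLinearMap
  map_F_le j := by
    by_cases h : Odd n ∧ 0 < n
    · rw [weil_F H₁ h, weil_F H₂ h]
      by_cases hj : j ≤ 0
      · rw [twoStepFiltration_of_le_zero H₂.weilPiece hj]
        exact le_top
      by_cases hjn : n < j
      · rw [twoStepFiltration_of_lt H₁.weilPiece (not_le.1 hj) hjn, Submodule.map_bot]
        exact bot_le
      rw [twoStepFiltration_of_pos_of_le H₁.weilPiece (not_le.1 hj) (not_lt.1 hjn),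
        twoStepFiltration_of_pos_of_le H₂.weilPiece (not_le.1 hj) (not_lt.1 hjn)]
      exact f.map_weilPiece_le
    · rw [weil_of_not H₁ h, weil_of_not H₂ h]
      exact f.map_F_le j

/-- `f.weil` has the same underlying linear map as `f`. [folklore] -/
@[simp]
theorem Hom.weil_toLinearMap {H₁ : HodgeStructure V n} {H₂ : HodgeStructure W n} (f : Hom H₁ H₂) :
    f.weil.toLinearMap = f.toLinearMap := rfl

/-! ### Polarization -/

/-- On Weil's half (odd `n`), the phase `i^p (i^{n-p})⁻¹`, `p` odd, is constantly
`i^n (i^0)⁻¹ = i^n`. [folklore] -/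
theorem I_zpow_mul_inv_of_odd (hn : Odd n) {p : ℤ} (hp : Odd p) :
    Complex.I ^ p * (Complex.I ^ (n - p))⁻¹ = Complex.I ^ n * (Complex.I ^ (0 : ℤ))⁻¹ := by
  obtain ⟨k, hk⟩ := hp.sub_odd hn
  rw [zpow_zero, inv_one, mul_one, ← zpow_neg, ← zpow_add₀ Complex.I_ne_zero,
    show p + -(n - p) = n + 2 * (k + k) by omega, zpow_add₀ Complex.I_ne_zero, zpow_mul,
    zpow_ofNat, Complex.I_sq, Even.neg_one_zpow ⟨k, rfl⟩, mul_one]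

/-- On the conjugate half, the phase `i^p (i^{n-p})⁻¹`, `p` even, is constantly
`i^0 (i^n)⁻¹ = i^{-n}` (any `n`). [folklore] -/
theorem I_zpow_mul_inv_of_even {p : ℤ} (hp : Even p) :
    Complex.I ^ p * (Complex.I ^ (n - p))⁻¹ = Complex.I ^ (0 : ℤ) * (Complex.I ^ n)⁻¹ := by
  obtain ⟨k, hk⟩ := hp
  rw [zpow_zero, one_mul, ← zpow_neg, ← zpow_neg, ← zpow_add₀ Complex.I_ne_zero,
    show p + -(n - p) = -n + 2 * (k + k) by omega, zpow_add₀ Complex.I_ne_zero, zpow_mul,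
    zpow_ofNat, Complex.I_sq, Even.neg_one_zpow ⟨k, rfl⟩, mul_one]

/-- **A polarization of `H` polarizes `H.weil`** (odd positive weight; for other weights
`H.weil = H`): the same form `Q`. First relation: `Q_ℂ(P, P) = 0` for `P = ⊕_{p odd} V^{p,n-p}`,
since `p + p'` is even `≠ n` (`form_eq_zero_of_mem_biSup`); second relation: on `V^{n,0} = P` the
phase `i^p (i^{n-p})⁻¹` is constantly `i^n`, on `V^{0,n} = conj P ⊆ ⊕_{p even} V^{p,n-p}` it is
constantly `i^{-n}`, and the decomposition is orthogonal (`exists_pos_of_mem_biSup`). This is the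
polarization of Weil's Jacobian ("the Weil Jacobian does get a natural polarization and so it is
an abelian variety", Carlson–Müller-Stach–Peters §3.5). [cite: CarlsonMullerStachPeters2017, §3.5 eq. (3.5)] -/
def Polarization.weil {H : HodgeStructure V n} (Q : Polarization H) : Polarization H.weil where
  form := Q.form
  flip_form := Q.flip_form
  form_apply_eq_zero j x hx y hy := by
    by_cases h : Odd n ∧ 0 < n
    · rw [weil_F H h] at hx hy
      by_cases hj : j ≤ 0
      · rw [twoStepFiltration_of_lt H.weilPiece (by omega) (by omega), Submodule.mem_bot] at hy
        rw [hy, map_zero]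
      by_cases hjn : n < j
      · rw [twoStepFiltration_of_lt H.weilPiece (not_le.1 hj) hjn, Submodule.mem_bot] at hx
        rw [hx, map_zero, LinearMap.zero_apply]
      rw [twoStepFiltration_of_pos_of_le H.weilPiece (not_le.1 hj) (not_lt.1 hjn)] at hx
      rw [twoStepFiltration_of_pos_of_le H.weilPiece (by omega) (by omega)] at hy
      exact Q.form_eq_zero_of_mem_biSup
        (fun p p' hp hp' he => (Int.not_even_iff_odd.2 h.1) (he ▸ hp.add_odd hp')) hx hy
    · rw [weil_of_not H h] at hx hy
      exact Q.form_apply_eq_zero j x hx y hy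
  pos p q hpq x hx hx0 := by
    by_cases h : Odd n ∧ 0 < n
    · rw [weil_of H h] at hx
      by_cases h₁ : p = n ∧ q = 0
      · obtain ⟨rfl, rfl⟩ := h₁
        rw [piece_ofSplitting_self_zero] at hx
        exact Q.exists_pos_of_mem_biSup (fun p hp => I_zpow_mul_inv_of_odd h.1 hp) hx hx0
      by_cases h₂ : p = 0 ∧ q = n
      · obtain ⟨rfl, rfl⟩ := h₂
        rw [piece_ofSplitting_zero_self] at hx
        exact Q.exists_pos_of_mem_biSup (fun p hp => I_zpow_mul_inv_of_even hp)
          (H.complexConj_weilPiece_le h.1 hx) hx0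
      · rw [piece_ofSplitting_eq_bot _ _ _ h₁ h₂, Submodule.mem_bot] at hx
        exact (hx0 hx).elim
    · rw [weil_of_not H h] at hx
      exact Q.pos p q hpq x hx hx0

/-- The form of `Q.weil` is the form of `Q`. [folklore] -/
@[simp]
theorem Polarization.weil_form {H : HodgeStructure V n} (Q : Polarization H) : Q.weil.form = Q.form :=
  rfl

/-- **`H.weil` is polarizable if `H` is** (Weil's Jacobian of a polarized Hodge structure of odd
weight is an abelian variety; Carlson–Müller-Stach–Peters §3.5). [cite: CarlsonMullerStachPeters2017, §3.5 eq. (3.5)] -/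
theorem IsPolarizable.weil {H : HodgeStructure V n} (h : H.IsPolarizable) : H.weil.IsPolarizable :=
  h.elim fun Q => ⟨Q.weil⟩

end HodgeStructure

end Literature.AlgebraicGeometry.Motives

end
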